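import Mathlib
import HarnessLib
import Summits.AtomisticToContinuum.HydrodynamicLimit.Theorems.AntiMazurCoboundariesInfluenceLocalityFirstMomentObjects

/-!
# Stub `stub_tailArith` of line `slab-percolation-shadow` (crux `InfluenceLocality`,
# stmt-AtomisticToContinuum-13916; route AntiMazurCoboundaries): the tail arithmetic

Pure real analysis. With `S ≤ 48 W T + 2` slabs, `W ≤ √θ √R + c`, and `r₀` forced links,
`R / (4σ) ≤ S (r₀ + 2)`, the assembled chain-tail bound `4 S (1/32)^{r₀} (64 R³ + r₀ + 1)` is
eventually (in `R`, uniformly in `S, r₀, W` subject to the constraints) `≤ η`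
(`TailArith` of the objects module `AntiMazurCoboundariesInfluenceLocalityFirstMomentObjects`, proved here
as `stub_tailArith`).

Proof. For `R ≥ 1`: `S ≤ A √R` with `A = 48 (√θ + c) T + 2`, hence `√R ≤ 4 σ A (r₀ + 2)` from the
forcing `R / (4σ) ≤ S (r₀ + 2)`; `(1/32)^{r₀} (64 R³ + r₀ + 1) ≤ (1/16)^{r₀} (64 R³ + 1) ≤ 65 R³ e^{-r₀}`
(`r₀ + 1 ≤ 2^{r₀}`, `1/16 ≤ e^{-1}`) `≤ 65 R³ e² e^{-κ √R}` (`κ = 1/(4σA)`), so the bound is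
`≤ 260 A e² R⁴ e^{-κ√R}`, and `R⁴ e^{-κ√R} → 0`
(`Real.tendsto_pow_mul_exp_neg_atTop_nhds_zero 8` along `x = κ √R`).
-/

namespace Summit.AtomisticToContinuum.HydrodynamicLimit.Theorems.TrueAnchoredInfection

open Filter Topology Real

noncomputable section

/-- Decay of the assembled bound: for `κ > 0`, `C ≥ 0`, `η > 0` there is `R₀ ≥ 1` with
`C R⁴ e^{-κ √R} ≤ η` for all `R ≥ R₀` (`x⁸ e^{-x} → 0` along `x = κ √R`). -/
private theorem exists_pow_four_mul_exp_neg_sqrt_le {κ C η : ℝ} (hκ : 0 < κ) (hC : 0 ≤ C)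
    (hη : 0 < η) :
    ∃ R₀ : ℝ, 1 ≤ R₀ ∧ ∀ R : ℝ, R₀ ≤ R → C * R ^ 4 * exp (-(κ * Real.sqrt R)) ≤ η := by
  have hlim := Real.tendsto_pow_mul_exp_neg_atTop_nhds_zero 8
  have hε : (0 : ℝ) < η * κ ^ 8 / (C + 1) := by positivity
  have hev : ∀ᶠ x in atTop, x ^ 8 * exp (-x) ≤ η * κ ^ 8 / (C + 1) :=
    (hlim.eventually (ge_mem_nhds hε)).mono fun x hx => hx
  obtain ⟨X₀, hX₀⟩ := eventually_atTop.1 hev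
  obtain ⟨Y, hY⟩ : ∃ Y : ℝ, Y = max X₀ 1 := ⟨_, rfl⟩
  have hY1 : 1 ≤ Y := hY ▸ le_max_right _ _
  have hY0 : 0 ≤ Y := zero_le_one.trans hY1
  have hYκ : 0 ≤ Y / κ := div_nonneg hY0 hκ.le
  refine ⟨max 1 ((Y / κ) ^ 2), le_max_left _ _, fun R hR => ?_⟩
  have hR1 : 1 ≤ R := le_trans (le_max_left _ _) hR
  have hR0 : 0 ≤ R := zero_le_one.trans hR1
  -- `Y / κ ≤ √R`, i.e. `Y ≤ x := κ √R`
  have hsq : Y / κ ≤ Real.sqrt R := by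
    rw [Real.le_sqrt hYκ hR0]
    exact le_trans (le_max_right _ _) hR
  obtain ⟨x, hx⟩ : ∃ x : ℝ, x = κ * Real.sqrt R := ⟨_, rfl⟩
  have hxY : Y ≤ x := by
    have h := mul_le_mul_of_nonneg_left hsq hκ.le
    rwa [mul_div_cancel₀ _ hκ.ne', ← hx] at h
  have hx8 : x ^ 8 * exp (-x) ≤ η * κ ^ 8 / (C + 1) := hX₀ x ((hY ▸ le_max_left X₀ 1).trans hxY)
  -- `R ^ 4 = (x / κ) ^ 8`
  have hsqrtR : Real.sqrt R = x / κ := by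
    rw [hx, mul_div_cancel_left₀ _ hκ.ne']
  have hR4 : R ^ 4 = (x / κ) ^ 8 := by
    rw [← hsqrtR]
    calc R ^ 4 = (Real.sqrt R ^ 2) ^ 4 := by rw [Real.sq_sqrt hR0]
      _ = Real.sqrt R ^ 8 := by ring
  calc C * R ^ 4 * exp (-(κ * Real.sqrt R)) = C / κ ^ 8 * (x ^ 8 * exp (-x)) := by
        rw [hR4, ← hx, div_pow]
        field_simp
    _ ≤ C / κ ^ 8 * (η * κ ^ 8 / (C + 1)) := by gcongr
    _ = η * (C / (C + 1)) := by field_simp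
    _ ≤ η * 1 := by
        gcongr
        rw [div_le_one (by positivity)]
        linarith
    _ = η := mul_one η

/-- Stub `stub_tailArith`: **the tail arithmetic** `TailArith` — for `R ≥ R₀(σ, θ, T, c, η)`,
`4 S (1/32)^{r₀} (64 R³ + r₀ + 1) ≤ η` whenever `S ≤ 48 W T + 2`, `0 ≤ W ≤ √θ √R + c` and
`R / (4σ) ≤ S (r₀ + 2)`. -/
theorem stub_tailArith : TailArith := by
  intro σ θ T c η hσ _hθ hT hc hη
  -- the constants `A = 48 (√θ + c) T + 2` (so that `S ≤ A √R` for `R ≥ 1`) and `κ = 1 / (4 σ A)`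
  obtain ⟨A, hA⟩ : ∃ A : ℝ, A = 48 * (Real.sqrt θ + c) * T + 2 := ⟨_, rfl⟩
  have hApos : 0 < A := by rw [hA]; positivity
  obtain ⟨κ, hκ⟩ : ∃ κ : ℝ, κ = 1 / (4 * σ * A) := ⟨_, rfl⟩
  have hκpos : 0 < κ := by rw [hκ]; positivity
  obtain ⟨R₀, hR₀, hdec⟩ :=
    exists_pow_four_mul_exp_neg_sqrt_le hκpos (by positivity : (0 : ℝ) ≤ 260 * A * exp 2) hη
  refine ⟨R₀, zero_lt_one.trans_le hR₀, fun R hR S r₀ W _hW hWle hS hforce => ?_⟩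
  have hR1 : 1 ≤ R := hR₀.trans hR
  have hR0 : 0 ≤ R := zero_le_one.trans hR1
  have hsqrt1 : 1 ≤ Real.sqrt R := by rw [← Real.sqrt_one]; exact Real.sqrt_le_sqrt hR1
  have hsqrt0 : 0 < Real.sqrt R := zero_lt_one.trans_le hsqrt1
  have hsqrtR : Real.sqrt R ≤ R := by
    rw [Real.sqrt_le_left hR0]
    nlinarith
  -- (a) `S ≤ A √R`
  have hSA : (S : ℝ) ≤ A * Real.sqrt R := by
    have hcc : c ≤ c * Real.sqrt R := le_mul_of_one_le_right hc hsqrt1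
    have h1 : W ≤ (Real.sqrt θ + c) * Real.sqrt R := by nlinarith [hWle, hcc]
    have h2 : (2 : ℝ) ≤ 2 * Real.sqrt R := by linarith
    have h3 : 48 * W * T ≤ 48 * ((Real.sqrt θ + c) * Real.sqrt R) * T := by gcongr
    calc (S : ℝ) ≤ 48 * W * T + 2 := hS
      _ ≤ 48 * ((Real.sqrt θ + c) * Real.sqrt R) * T + 2 * Real.sqrt R := add_le_add h3 h2
      _ = A * Real.sqrt R := by rw [hA]; ring
  -- (b) the forcing: `√R ≤ 4 σ A (r₀ + 2)`, i.e. `κ √R ≤ r₀ + 2`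
  have hr₀ : Real.sqrt R ≤ 4 * σ * A * ((r₀ : ℝ) + 2) := by
    have h1 : R ≤ (S : ℝ) * ((r₀ : ℝ) + 2) * (4 * σ) := (div_le_iff₀ (by positivity)).1 hforce
    have h2 : R ≤ A * Real.sqrt R * ((r₀ : ℝ) + 2) * (4 * σ) := h1.trans (by gcongr)
    have h3 : Real.sqrt R * Real.sqrt R ≤ Real.sqrt R * (4 * σ * A * ((r₀ : ℝ) + 2)) := by
      calc Real.sqrt R * Real.sqrt R = R := Real.mul_self_sqrt hR0
        _ ≤ A * Real.sqrt R * ((r₀ : ℝ) + 2) * (4 * σ) := h2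
        _ = Real.sqrt R * (4 * σ * A * ((r₀ : ℝ) + 2)) := by ring
    exact le_of_mul_le_mul_left h3 hsqrt0
  have hκr₀ : κ * Real.sqrt R ≤ (r₀ : ℝ) + 2 := by
    rw [hκ, one_div, inv_mul_le_iff₀ (by positivity)]
    exact hr₀
  -- (c) kill the polynomial in `r₀`: `(1/32)^{r₀} (64 R³ + r₀ + 1) ≤ (1/16)^{r₀} · 65 R³`
  have hpoly : (1 / 32 : ℝ) ^ r₀ * (64 * R ^ 3 + r₀ + 1) ≤ (1 / 16 : ℝ) ^ r₀ * (65 * R ^ 3) := by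
    have hnat : r₀ + 1 ≤ 2 ^ r₀ := Nat.lt_two_pow_self
    have h2 : (r₀ : ℝ) + 1 ≤ 2 ^ r₀ := by exact_mod_cast hnat
    have hp : ((r₀ : ℝ) + 1) * (1 / 2 : ℝ) ^ r₀ ≤ 1 := by
      rw [div_pow, one_pow, mul_one_div, div_le_one (by positivity)]
      exact h2
    have hhalf : (1 / 2 : ℝ) ^ r₀ ≤ 1 := pow_le_one₀ (by norm_num) (by norm_num)
    have hR3 : 1 ≤ R ^ 3 := one_le_pow₀ hR1
    have hsplit : (1 / 32 : ℝ) ^ r₀ = (1 / 16) ^ r₀ * (1 / 2) ^ r₀ := by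
      rw [← mul_pow]; norm_num
    rw [hsplit]
    have hq : 0 ≤ (1 / 16 : ℝ) ^ r₀ := by positivity
    calc (1 / 16 : ℝ) ^ r₀ * (1 / 2) ^ r₀ * (64 * R ^ 3 + r₀ + 1)
        = (1 / 16 : ℝ) ^ r₀ * ((1 / 2) ^ r₀ * (64 * R ^ 3) + ((r₀ : ℝ) + 1) * (1 / 2) ^ r₀) := by
          ring
      _ ≤ (1 / 16 : ℝ) ^ r₀ * (1 * (64 * R ^ 3) + 1) := by
          apply mul_le_mul_of_nonneg_left _ hq
          exact add_le_add (mul_le_mul_of_nonneg_right hhalf (by positivity)) hp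
      _ ≤ (1 / 16 : ℝ) ^ r₀ * (65 * R ^ 3) := by
          apply mul_le_mul_of_nonneg_left _ hq
          linarith
  -- (d) the stretched exponential: `(1/16)^{r₀} ≤ e^{-r₀} ≤ e² e^{-κ √R}`
  have hexp : (1 / 16 : ℝ) ^ r₀ ≤ exp 2 * exp (-(κ * Real.sqrt R)) := by
    have h16 : (1 / 16 : ℝ) ≤ exp (-1) := by
      rw [exp_neg, one_div]
      exact inv_anti₀ (exp_pos 1) (Real.exp_one_lt_three.le.trans (by norm_num))
    calc (1 / 16 : ℝ) ^ r₀ ≤ exp (-1) ^ r₀ := pow_le_pow_left₀ (by norm_num) h16 r₀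
      _ = exp (-(r₀ : ℝ)) := by rw [← Real.exp_nat_mul]; congr 1; ring
      _ ≤ exp (2 - κ * Real.sqrt R) := by rw [exp_le_exp]; linarith
      _ = exp 2 * exp (-(κ * Real.sqrt R)) := by rw [sub_eq_add_neg, exp_add]
  -- (e) assemble
  have ht : 0 ≤ (1 / 32 : ℝ) ^ r₀ * (64 * R ^ 3 + r₀ + 1) := by positivity
  calc 4 * (S : ℝ) * (1 / 32) ^ r₀ * (64 * R ^ 3 + r₀ + 1)
      = 4 * (S : ℝ) * ((1 / 32) ^ r₀ * (64 * R ^ 3 + r₀ + 1)) := by ring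
    _ ≤ 4 * (A * Real.sqrt R) * ((1 / 16 : ℝ) ^ r₀ * (65 * R ^ 3)) :=
        mul_le_mul (by linarith) hpoly ht (by positivity)
    _ ≤ 4 * (A * R) * (exp 2 * exp (-(κ * Real.sqrt R)) * (65 * R ^ 3)) := by
        apply mul_le_mul _ _ (by positivity) (by positivity)
        · exact mul_le_mul_of_nonneg_left (mul_le_mul_of_nonneg_left hsqrtR hApos.le) (by norm_num)
        · exact mul_le_mul_of_nonneg_right hexp (by positivity)
    _ = 260 * A * exp 2 * R ^ 4 * exp (-(κ * Real.sqrt R)) := by ring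
    _ ≤ η := hdec R hR

end

end Summit.AtomisticToContinuum.HydrodynamicLimit.Theorems.TrueAnchoredInfection
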